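import Summits.ResolutionOfSingularities.ResolutionOfSingularities.Theorems.FrobeniusClosingPatchingRelPerfectDepthPhaseCMonomialTailLaws
import HarnessLib

/-!
# Crux `PatchingRelPerfect` (stmt-ResolutionOfSingularities-16161), chain W5.2 — F7(β) (β-AX) X3 C-II (tail lemma):
# the A8 NORMALISATION LEAF of the pure-member tail class — `K̄ = D · K̄♭`, `D` the letter-wise minimum, `K̄♭` the residual table

[OURS · L1 W5.2 · F7(β) (β-AX) X3 `PhaseCTermination₂` C-II · res-L1-w52-plan-1 RULING G11-25 (A8 «residual currency» `K = M·K♭`) ·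
res-L1-w52-idea-1 ANSWER to NAMING (B) 17:01:48Z «the A8 normalisation leaf "K♭ = table − letterwise min" — strips then need no separate law;
K♭ = ⊤ ⟺ some generator row is 0»] res-L1-w52-stub-1 g5.  Replaces the role of NO printed item; NOT a statement of the manuscript under review
(AI-written, weaker than expert review).  Ring level, ANY commutative ring, `k` letters `s : Fin k → A` (members AND free letters alike),
exponent VECTORS `a b : Fin k → ℕ`, a unit `U` carried:

* `prod_pow_eq_prod_min_mul` — `∏ sᵢ^{aᵢ} = ∏ sᵢ^{min(aᵢ,bᵢ)} · ∏ sᵢ^{aᵢ − min(aᵢ,bᵢ)}` (and the same for `b`);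
* **`pair_eq_monomial_mul_residual`** — on the carrier, `(U·q^a) + (q^b) = q^{min(a,b)} · ((U·q^{a − min}) + (q^{b − min}))`: the two-summand
  ideal is the common monomial `D` times the RESIDUAL table («table minus its letter-wise minimum»);
* `germ_eq_sup_monomial_mul_residual` — at `X`-level with the bare carrier host: `(g) + (g + U·q^a) + (q^b) = (g) + D · K̄♭`;
* leaves: **`residual_eq_top_of_le`** / **`residual_eq_top_of_ge`** — if one residual row vanishes (`a ≤ b` or `b ≤ a` letter-wise, i.e.
  `M ∣ N̄` or `N̄ ∣ M`) the residual is the UNIT ideal (RULING G11-25 A9's target «`K♭` a unit» at the point), and then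
  `germ_eq_sup_monomial_of_le/_of_ge`: `K = (g) + (D)`.

With `…DepthPhaseCMonomialTailLaws` (`tail_chart_general`: every chart keeps all exponents but the new letter's `|α_I| − 1`) this is the whole
one-step calculus of idea-1's exponent game (F1); the Ψ-descent (F2) is the next brick.  Fact-free.

## References
* J. Kollár, *Lectures on Resolution of Singularities* (2007), (3.111) Step 3 (monomial bookkeeping). [Kollar2007]
* The Stacks Project, Tag 0804. [StacksProject]
-/

-- `Summit.<Summit>.<Sub>.Theorems` with `Sub = Summit` (single-conjunct summit, D-0017)
set_option linter.dupNamespace false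

noncomputable section

open Literature.AlgebraicGeometry.Resolution
open scoped BigOperators

namespace Summit.ResolutionOfSingularities.ResolutionOfSingularities.Theorems

universe u

namespace DepthPhaseC

/-- The letter-class germ `K = (g) + (g + φ) + (n)` (as in `…DepthPhaseCLetterLaws`). -/
local notation3 "Kl[" g "," φ "," n "]" => (Ideal.span {g} ⊔ Ideal.span {g + φ} ⊔ Ideal.span {n})

section Residual

variable {A : Type u} [CommRing A] {k : ℕ}

/-- **Splitting off the letter-wise minimum**: `∏ sᵢ^{aᵢ} = ∏ sᵢ^{min(aᵢ,bᵢ)} · ∏ sᵢ^{aᵢ − min(aᵢ,bᵢ)}`. [folklore] -/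
theorem prod_pow_eq_prod_min_mul (s : Fin k → A) (a b : Fin k → ℕ) :
    ∏ i, s i ^ a i = (∏ i, s i ^ min (a i) (b i)) * ∏ i, s i ^ (a i - min (a i) (b i)) := by
  rw [← Finset.prod_mul_distrib]
  exact Finset.prod_congr rfl fun i _ => by rw [← pow_add, Nat.add_sub_cancel' (min_le_left _ _)]

/-- The same for the second vector: `∏ sᵢ^{bᵢ} = ∏ sᵢ^{min(aᵢ,bᵢ)} · ∏ sᵢ^{bᵢ − min(aᵢ,bᵢ)}`. [folklore] -/
theorem prod_pow_eq_prod_min_mul' (s : Fin k → A) (a b : Fin k → ℕ) :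
    ∏ i, s i ^ b i = (∏ i, s i ^ min (a i) (b i)) * ∏ i, s i ^ (b i - min (a i) (b i)) := by
  rw [← Finset.prod_mul_distrib]
  exact Finset.prod_congr rfl fun i _ => by rw [← pow_add, Nat.add_sub_cancel' (min_le_right _ _)]

/-- [OURS · L1 W5.2 · X3 C-II · A8] **The residual table**: `(U·q^a) + (q^b) = q^{min(a,b)} · ((U·q^{a − min}) + (q^{b − min}))` — the
two-summand carrier ideal is its common monomial times the ideal of the RESIDUAL exponent table (idea-1: «table minus its letter-wise
minimum»; RULING G11-25 A8 `K = M · K♭` read on the carrier). [cite: Kollar2007, (3.111) Step 3] -/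
theorem pair_eq_monomial_mul_residual (U : A) (s : Fin k → A) (a b : Fin k → ℕ) :
    Ideal.span {U * ∏ i, s i ^ a i} ⊔ Ideal.span {∏ i, s i ^ b i} =
      Ideal.span {∏ i, s i ^ min (a i) (b i)} *
        (Ideal.span {U * ∏ i, s i ^ (a i - min (a i) (b i))} ⊔ Ideal.span {∏ i, s i ^ (b i - min (a i) (b i))}) := by
  rw [Ideal.mul_sup, Ideal.span_singleton_mul_span_singleton, Ideal.span_singleton_mul_span_singleton,
    prod_pow_eq_prod_min_mul s a b, ← prod_pow_eq_prod_min_mul' s a b]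
  congr 2
  ring

/-- **At `X`-level with the bare carrier host `g`**: `(g) + (g + U·q^a) + (q^b) = (g) + D · ((U·q^{a − min}) + (q^{b − min}))`,
`D = q^{min(a,b)}`. [folklore] -/
theorem germ_eq_sup_monomial_mul_residual (g U : A) (s : Fin k → A) (a b : Fin k → ℕ) :
    Kl[g, U * ∏ i, s i ^ a i, ∏ i, s i ^ b i] =
      Ideal.span {g} ⊔ Ideal.span {∏ i, s i ^ min (a i) (b i)} *
        (Ideal.span {U * ∏ i, s i ^ (a i - min (a i) (b i))} ⊔ Ideal.span {∏ i, s i ^ (b i - min (a i) (b i))}) := by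
  rw [germ_eq, sup_assoc, pair_eq_monomial_mul_residual]

/-- **Residual-empty leaf, `a ≤ b`** (`M ∣ N̄` letter-wise): the residual table's first row is `0`, the residual ideal is the unit ideal.
[folklore] -/
theorem residual_eq_top_of_le {U : A} (hU : IsUnit U) (s : Fin k → A) {a b : Fin k → ℕ} (h : ∀ i, a i ≤ b i) :
    Ideal.span {U * ∏ i, s i ^ (a i - min (a i) (b i))} ⊔ Ideal.span {∏ i, s i ^ (b i - min (a i) (b i))} = ⊤ := by
  have h1 : ∏ i, s i ^ (a i - min (a i) (b i)) = 1 :=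
    Finset.prod_eq_one fun i _ => by rw [min_eq_left (h i), Nat.sub_self, pow_zero]
  rw [h1, mul_one, Ideal.span_singleton_eq_top.mpr hU, top_sup_eq]

/-- **Residual-empty leaf, `b ≤ a`** (`N̄ ∣ M` letter-wise): the second row is `0`, the residual ideal is the unit ideal. [folklore] -/
theorem residual_eq_top_of_ge (U : A) (s : Fin k → A) {a b : Fin k → ℕ} (h : ∀ i, b i ≤ a i) :
    Ideal.span {U * ∏ i, s i ^ (a i - min (a i) (b i))} ⊔ Ideal.span {∏ i, s i ^ (b i - min (a i) (b i))} = ⊤ := by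
  have h1 : ∏ i, s i ^ (b i - min (a i) (b i)) = 1 :=
    Finset.prod_eq_one fun i _ => by rw [min_eq_right (h i), Nat.sub_self, pow_zero]
  rw [h1, Ideal.span_singleton_one, sup_top_eq]

/-- **Then the germ is the carrier host plus ONE monomial**: `a ≤ b` letter-wise ⇒ `K = (g) + (q^a)`. [folklore] -/
theorem germ_eq_sup_monomial_of_le (g : A) {U : A} (hU : IsUnit U) (s : Fin k → A) {a b : Fin k → ℕ} (h : ∀ i, a i ≤ b i) :
    Kl[g, U * ∏ i, s i ^ a i, ∏ i, s i ^ b i] = Ideal.span {g} ⊔ Ideal.span {∏ i, s i ^ a i} := by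
  rw [germ_eq_sup_monomial_mul_residual, residual_eq_top_of_le hU s h, Ideal.mul_top]
  congr 3
  exact Finset.prod_congr rfl fun i _ => by rw [min_eq_left (h i)]

/-- `b ≤ a` letter-wise ⇒ `K = (g) + (q^b)`. [folklore] -/
theorem germ_eq_sup_monomial_of_ge (g U : A) (s : Fin k → A) {a b : Fin k → ℕ} (h : ∀ i, b i ≤ a i) :
    Kl[g, U * ∏ i, s i ^ a i, ∏ i, s i ^ b i] = Ideal.span {g} ⊔ Ideal.span {∏ i, s i ^ b i} := by
  rw [germ_eq_sup_monomial_mul_residual, residual_eq_top_of_ge U s h, Ideal.mul_top]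
  congr 3
  exact Finset.prod_congr rfl fun i _ => by rw [min_eq_right (h i)]

end Residual

end DepthPhaseC

end Summit.ResolutionOfSingularities.ResolutionOfSingularities.Theorems

end
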